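import Summits.QuantumFields.YangMills.Theorems.UnitScaleTiltProp7CampanatoIterationEps
import HarnessLib

/-!
# Route `UnitScaleTilt`, crux K1 «MinimiserStabilityRegPr» (stmt-QuantumFields-19200), EX row (5) `norm_G`, STOREY H, programme «H2-LOC» (chair WORD №60 (2)–(3)), brick (C3b, abstract
# half) — **FROM A CAMPANATO STEP WITH SLACK TO THE MORREY DECAY OF A BOX ENERGY**: for ANY nonnegative nondecreasing box functional `φ : ℤ → ℝ` (e.g. `ρ ↦ Σ_{Q_ρ(z)}‖∇_V u‖²` at a
# curved background, `W`-valued, torus or `ℤ³` — the currency is the caller's) obeying the integer-radius step `φ(ρ) ≤ (4A₀((ρ+1)∕(r+1))^d + ε)·φ(r) + B(r+1)^d` (`0 ≤ ρ ≤ r ≤ 2K`)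
# with `ε(4A)^d ≤ A`, `A = 4·2^d·A₀`: `φ(ρ) ≤ 2(4A)^{2(d−1)}·((ρ+1)∕(2K+1))^{d−1}·(φ(2K) + B(2K+1)^d)` for `0 ≤ ρ ≤ 2K` — lit ✓`B4Eq19LatticeInteriorHolder.campanato_hypothesis` +
# the iteration, made ABSTRACT in `φ` and given the slack `ε` (the covariant Dirichlet comparison's `(R(V)−1)∇_Vu` cross term, px19 g16 LOCATE-H2-FILE2 §3 (C)).

Cell `ym3-torus` (HUMAN RULING D-0037; rung R3 = SU(2) YM₃ on T³ — NOT d = 4, NOT infinite volume, NOT a mass gap, NOT Clay).  Width seat `ym3-torus-px21` (gen 16); chair WORD №60 (3)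
pen C3.  THEOREMS ONLY (0 `def`, 0 `sorry`, default heartbeats); `--supports stmt-QuantumFields-19200 --as helper`; count-neutral.

WHAT IS PROVED (ns `Summit.QuantumFields.YangMills.Theorems.Prop7CampanatoMorreyDecayEps`).
* §1 `campanato_hypothesis_eps` — integer radii → the real-variable hypothesis of ✓`campanato_iteration_eps` for `ψ(t) := φ(⌊t⌋ − 1)` on `[1, 2K+1]` (`⌊P⌋∕⌊R⌋ ≤ 2P∕R`, `⌊R⌋ ≤ R`;
  the slack term rides unchanged).
* §2 ★★★ `morrey_decay_eps` — THE DECAY: `∀ ρ, 0 ≤ ρ → ρ ≤ 2K → φ ρ ≤ 2(4A)^{2(d−1)}·((ρ+1)∕(2K+1))^{d−1}·(φ(2K) + B(2K+1)^d)`, `A = 4·2^d·A₀`, under `ε(4A)^d ≤ A`.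
  (C4 plugs in C1 = the top-scale Caccioppoli bound of `φ(2K)` and C2 = the step; at `d = 3` the exponent `d − 1 = 2` is Morrey's `½`-Hölder via lit ✓`abs_sub_le_of_morrey`.)
HONEST SCOPE.  Real-variable plumbing, proved; the covariant Caccioppoli (C1), the covariant Dirichlet comparison (C2), the `W₂`-componentwise Morrey step and the assembly (C4)(C5), `hHlocV`,
`hWsup`, FILE 2, norm_G, EX, 19200 and rung R3 are NOT proved here; the Yang–Mills mass gap is NOT proved.

References: M. Giaquinta, Annals of Math. Studies **105** (1983) [Giaquinta1984] (Ch. III Lemma 2.1 p. 86, Thm 2.2 p. 78); T. Bałaban, CMP **96** (1984) 223–250 [Balaban1984PropagatorsII]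
((1.9) p. 226); CMP **99** (1985) 389–434 [Balaban1985BackgroundPropagators] (Thm 3.1 (3.43) p. 398).
-/

set_option autoImplicit false

noncomputable section

namespace Summit.QuantumFields.YangMills.Theorems.Prop7CampanatoMorreyDecayEps

open Summit.QuantumFields.YangMills.Theorems.Prop7CampanatoIterationEps (campanato_iteration_eps)

/-! ## §1 Integer radii → the real-variable hypothesis, with slack -/

/-- **The real-variable Campanato hypothesis with slack** for `ψ(t) = φ(⌊t⌋ − 1)`: from the integer-radius step
`φ(ρ) ≤ (4A₀((ρ+1)∕(r+1))^d + ε)·φ(r) + B(r+1)^d` (`0 ≤ ρ ≤ r ≤ 2K`, `φ ≥ 0`) to `ψ(P) ≤ ((4·2^d A₀)(P∕R)^d + ε)·ψ(R) + B R^d` (`1 ≤ P ≤ R ≤ 2K+1`).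
[cite: Giaquinta1984, Ch. III Lemma 2.1 p.86] -/
theorem campanato_hypothesis_eps {φ : ℤ → ℝ} {d K : ℕ} {A₀ B ε : ℝ} (hA₀ : 0 ≤ A₀) (hB : 0 ≤ B) (hφ0 : ∀ ρ : ℤ, 0 ≤ ρ → 0 ≤ φ ρ)
    (hstep : ∀ ρ r : ℤ, 0 ≤ ρ → ρ ≤ r → r ≤ 2 * K →
      φ ρ ≤ (4 * A₀ * (((ρ : ℝ) + 1) / ((r : ℝ) + 1)) ^ d + ε) * φ r + B * ((r : ℝ) + 1) ^ d) :
    ∀ P R : ℝ, 1 ≤ P → P ≤ R → R ≤ 2 * (K : ℝ) + 1 →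
      φ (⌊P⌋ - 1) ≤ ((4 * 2 ^ d * A₀) * (P / R) ^ d + ε) * φ (⌊R⌋ - 1) + B * R ^ d := by
  intro P R hP hPR hR
  have hfP : (1 : ℤ) ≤ ⌊P⌋ := by have := Int.floor_le_floor hP; rwa [Int.floor_one] at this
  have hfPR : ⌊P⌋ ≤ ⌊R⌋ := Int.floor_le_floor hPR
  have hfR : ⌊R⌋ ≤ 2 * (K : ℤ) + 1 := by
    have := Int.floor_le_floor hR
    rwa [show (2 * (K : ℝ) + 1) = ((2 * (K : ℤ) + 1 : ℤ) : ℝ) by push_cast; ring, Int.floor_intCast] at this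
  have h := hstep (⌊P⌋ - 1) (⌊R⌋ - 1) (by linarith) (by linarith) (by linarith)
  have e1 : (((⌊P⌋ - 1 : ℤ) : ℝ) + 1) = (⌊P⌋ : ℝ) := by push_cast; ring
  have e2 : (((⌊R⌋ - 1 : ℤ) : ℝ) + 1) = (⌊R⌋ : ℝ) := by push_cast; ring
  rw [e1, e2] at h
  have hfR1 : (1 : ℝ) ≤ (⌊R⌋ : ℝ) := by have : (1:ℤ) ≤ ⌊R⌋ := hfP.trans hfPR; exact_mod_cast this
  have hfRpos : (0 : ℝ) < (⌊R⌋ : ℝ) := by linarith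
  have hR0 : 0 < R := by linarith
  have hratio : (⌊P⌋ : ℝ) / (⌊R⌋ : ℝ) ≤ 2 * (P / R) := by
    rw [div_le_iff₀ hfRpos]
    have h2 : R < (⌊R⌋ : ℝ) + 1 := Int.lt_floor_add_one R
    calc (⌊P⌋ : ℝ) ≤ P := Int.floor_le P
      _ = (P / R) * R := by field_simp
      _ ≤ (P / R) * (2 * (⌊R⌋ : ℝ)) := mul_le_mul_of_nonneg_left (by linarith) (by positivity)
      _ = 2 * (P / R) * (⌊R⌋ : ℝ) := by ring
  have hratio_d : ((⌊P⌋ : ℝ) / (⌊R⌋ : ℝ)) ^ d ≤ 2 ^ d * (P / R) ^ d := by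
    rw [← mul_pow]; exact pow_le_pow_left₀ (by positivity) hratio d
  have hRd : (⌊R⌋ : ℝ) ^ d ≤ R ^ d := pow_le_pow_left₀ hfRpos.le (Int.floor_le R) d
  have hψR0 : 0 ≤ φ (⌊R⌋ - 1) := hφ0 _ (by linarith)
  calc φ (⌊P⌋ - 1) ≤ (4 * A₀ * ((⌊P⌋ : ℝ) / (⌊R⌋ : ℝ)) ^ d + ε) * φ (⌊R⌋ - 1) + B * (⌊R⌋ : ℝ) ^ d := h
    _ = 4 * A₀ * ((⌊P⌋ : ℝ) / (⌊R⌋ : ℝ)) ^ d * φ (⌊R⌋ - 1) + ε * φ (⌊R⌋ - 1) + B * (⌊R⌋ : ℝ) ^ d := by ring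
    _ ≤ 4 * A₀ * (2 ^ d * (P / R) ^ d) * φ (⌊R⌋ - 1) + ε * φ (⌊R⌋ - 1) + B * R ^ d := by
        have t1 := mul_le_mul_of_nonneg_left hratio_d (by positivity : (0:ℝ) ≤ 4 * A₀)
        have t2 := mul_le_mul_of_nonneg_right t1 hψR0
        have t3 := mul_le_mul_of_nonneg_left hRd hB
        linarith
    _ = ((4 * 2 ^ d * A₀) * (P / R) ^ d + ε) * φ (⌊R⌋ - 1) + B * R ^ d := by ring

/-! ## §2 The Morrey decay of the box energy -/

/-- ★★★ **THE MORREY DECAY FROM A CAMPANATO STEP WITH SLACK.**  Let `d ≥ 1`, `A₀ ≥ 1`, `B ≥ 0`, `A := 4·2^d·A₀`, `ε(4A)^d ≤ A`; let `φ : ℤ → ℝ` be nonnegative on `ρ ≥ 0` and nondecreasing,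
with the step `φ(ρ) ≤ (4A₀((ρ+1)∕(r+1))^d + ε)·φ(r) + B(r+1)^d` for `0 ≤ ρ ≤ r ≤ 2K`.  Then for `0 ≤ ρ ≤ 2K`:
`φ(ρ) ≤ 2(4A)^{2(d−1)}·((ρ+1)∕(2K+1))^{d−1}·(φ(2K) + B·(2K+1)^d)` (✓`campanato_iteration_eps` for `ψ(t) = φ(⌊t⌋−1)` on `[1, 2K+1]`, evaluated at `P = ρ+1`, `R = 2K+1`).
[cite: Giaquinta1984, Ch. III Lemma 2.1 p.86, Thm 2.2 p.78; Balaban1984PropagatorsII, (1.9) p.226] -/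
theorem morrey_decay_eps {φ : ℤ → ℝ} {d K : ℕ} (hd : 1 ≤ d) {A₀ B ε : ℝ} (hA₀ : 1 ≤ A₀) (hB : 0 ≤ B)
    (hεA : ε * (4 * (4 * 2 ^ d * A₀)) ^ d ≤ 4 * 2 ^ d * A₀)
    (hφ0 : ∀ ρ : ℤ, 0 ≤ ρ → 0 ≤ φ ρ) (hmono : ∀ ρ r : ℤ, 0 ≤ ρ → ρ ≤ r → φ ρ ≤ φ r)
    (hstep : ∀ ρ r : ℤ, 0 ≤ ρ → ρ ≤ r → r ≤ 2 * K →
      φ ρ ≤ (4 * A₀ * (((ρ : ℝ) + 1) / ((r : ℝ) + 1)) ^ d + ε) * φ r + B * ((r : ℝ) + 1) ^ d) :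
    ∀ ρ : ℤ, 0 ≤ ρ → ρ ≤ 2 * K →
      φ ρ ≤ 2 * (4 * (4 * 2 ^ d * A₀)) ^ (2 * (d - 1)) * (((ρ : ℝ) + 1) / (2 * (K : ℝ) + 1)) ^ (d - 1) * (φ (2 * K) + B * (2 * (K : ℝ) + 1) ^ d) := by
  have hA₀0 : 0 ≤ A₀ := by linarith
  set A : ℝ := 4 * 2 ^ d * A₀ with hAdef
  have hA1 : 1 ≤ A := by
    rw [hAdef]
    exact one_le_mul_of_one_le_of_one_le (one_le_mul_of_one_le_of_one_le (by norm_num) (one_le_pow₀ (by norm_num))) hA₀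
  have hiter := campanato_iteration_eps (ψ := fun t => φ (⌊t⌋ - 1)) (R₀ := 2 * (K : ℝ) + 1) hd hA1 hB hεA
    (fun t ht _ => hφ0 _ (by have := Int.floor_le_floor ht; rw [Int.floor_one] at this; linarith))
    (fun s t hs hst _ => hmono _ _ (by have := Int.floor_le_floor hs; rw [Int.floor_one] at this; linarith) (by linarith [Int.floor_le_floor hst]))
    (campanato_hypothesis_eps hA₀0 hB hφ0 hstep)
  intro ρ hρ hρK
  have hρR : (0 : ℝ) ≤ ρ := by exact_mod_cast hρ
  have hρKR : (ρ : ℝ) ≤ 2 * K := by exact_mod_cast hρK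
  have hmain := hiter ((ρ : ℝ) + 1) (2 * (K : ℝ) + 1) (by linarith) (by linarith) le_rfl
  have eP : ⌊(ρ : ℝ) + 1⌋ - 1 = ρ := by
    rw [show (ρ : ℝ) + 1 = ((ρ + 1 : ℤ) : ℝ) by push_cast; ring, Int.floor_intCast]; ring
  have eR : ⌊2 * (K : ℝ) + 1⌋ - 1 = 2 * (K : ℤ) := by
    rw [show 2 * (K : ℝ) + 1 = ((2 * (K : ℤ) + 1 : ℤ) : ℝ) by push_cast; ring, Int.floor_intCast]; ring
  simp only [eP, eR] at hmain
  exact hmain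

/-- **The `(ρ+1)^{d−1}∕K` form** (lit's `morrey_bound` shape): if moreover the top scale and the inhomogeneity are bounded by `N₀·K^{d−1}` — `φ(2K) + B(2K+1)^d ≤ N₀·K^{d−1}` (the covariant
Caccioppoli bound at scale `K`, C1, supplies exactly this with `N₀ ∝ (M_u + Km + …)²∕K`-type constants) — then `φ(ρ) ≤ 2(4A)^{2(d−1)}·N₀·(ρ+1)^{d−1}` for `0 ≤ ρ ≤ 2K` (`K ≥ 1`).
[cite: Giaquinta1984, Ch. III Thm 2.2 p.78] -/
theorem morrey_decay_eps_pow {φ : ℤ → ℝ} {d K : ℕ} (hd : 1 ≤ d) (hK : 1 ≤ K) {A₀ B ε N₀ : ℝ} (hA₀ : 1 ≤ A₀) (hB : 0 ≤ B) (hN₀ : 0 ≤ N₀)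
    (hεA : ε * (4 * (4 * 2 ^ d * A₀)) ^ d ≤ 4 * 2 ^ d * A₀)
    (hφ0 : ∀ ρ : ℤ, 0 ≤ ρ → 0 ≤ φ ρ) (hmono : ∀ ρ r : ℤ, 0 ≤ ρ → ρ ≤ r → φ ρ ≤ φ r)
    (hstep : ∀ ρ r : ℤ, 0 ≤ ρ → ρ ≤ r → r ≤ 2 * K →
      φ ρ ≤ (4 * A₀ * (((ρ : ℝ) + 1) / ((r : ℝ) + 1)) ^ d + ε) * φ r + B * ((r : ℝ) + 1) ^ d)
    (htop : φ (2 * K) + B * (2 * (K : ℝ) + 1) ^ d ≤ N₀ * (K : ℝ) ^ (d - 1)) :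
    ∀ ρ : ℤ, 0 ≤ ρ → ρ ≤ 2 * K → φ ρ ≤ 2 * (4 * (4 * 2 ^ d * A₀)) ^ (2 * (d - 1)) * N₀ * ((ρ : ℝ) + 1) ^ (d - 1) := by
  intro ρ hρ hρK
  have h := morrey_decay_eps hd hA₀ hB hεA hφ0 hmono hstep ρ hρ hρK
  have hK0 : (0 : ℝ) < K := by exact_mod_cast hK
  have hρR : (0 : ℝ) ≤ ρ := by exact_mod_cast hρ
  set C : ℝ := 2 * (4 * (4 * 2 ^ d * A₀)) ^ (2 * (d - 1)) with hC
  have hC0 : 0 ≤ C := by positivity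
  -- `((ρ+1)/(2K+1))^{d-1} · N₀ K^{d-1} ≤ N₀ (ρ+1)^{d-1}`
  have hscale : (((ρ : ℝ) + 1) / (2 * (K : ℝ) + 1)) ^ (d - 1) * (N₀ * (K : ℝ) ^ (d - 1)) ≤ N₀ * ((ρ : ℝ) + 1) ^ (d - 1) := by
    rw [div_pow]
    have hK1 : (K : ℝ) ^ (d - 1) ≤ (2 * (K : ℝ) + 1) ^ (d - 1) := pow_le_pow_left₀ hK0.le (by linarith) _
    have hpos : (0 : ℝ) < (2 * (K : ℝ) + 1) ^ (d - 1) := by positivity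
    rw [div_mul_eq_mul_div, div_le_iff₀ hpos]
    have hρ1 : (0 : ℝ) ≤ ((ρ : ℝ) + 1) ^ (d - 1) := by positivity
    calc ((ρ : ℝ) + 1) ^ (d - 1) * (N₀ * (K : ℝ) ^ (d - 1)) = N₀ * ((ρ : ℝ) + 1) ^ (d - 1) * (K : ℝ) ^ (d - 1) := by ring
      _ ≤ N₀ * ((ρ : ℝ) + 1) ^ (d - 1) * (2 * (K : ℝ) + 1) ^ (d - 1) := mul_le_mul_of_nonneg_left hK1 (by positivity)
  calc φ ρ ≤ C * (((ρ : ℝ) + 1) / (2 * (K : ℝ) + 1)) ^ (d - 1) * (φ (2 * K) + B * (2 * (K : ℝ) + 1) ^ d) := h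
    _ ≤ C * (((ρ : ℝ) + 1) / (2 * (K : ℝ) + 1)) ^ (d - 1) * (N₀ * (K : ℝ) ^ (d - 1)) := mul_le_mul_of_nonneg_left htop (by positivity)
    _ = C * ((((ρ : ℝ) + 1) / (2 * (K : ℝ) + 1)) ^ (d - 1) * (N₀ * (K : ℝ) ^ (d - 1))) := by ring
    _ ≤ C * (N₀ * ((ρ : ℝ) + 1) ^ (d - 1)) := mul_le_mul_of_nonneg_left hscale hC0
    _ = C * N₀ * ((ρ : ℝ) + 1) ^ (d - 1) := by ring

end Summit.QuantumFields.YangMills.Theorems.Prop7CampanatoMorreyDecayEps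

end
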